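import Summits.NavierStokesRegularity.NavierStokesRegularity.Theorems.EulerZoomLiouvillePowerGaugeEulerLiouvilleWeakCasimirRace
import Summits.NavierStokesRegularity.NavierStokesRegularity.Theorems.EulerZoomLiouvillePowerGaugeEulerLiouvilleWeakVorticityEquation
import Summits.NavierStokesRegularity.NavierStokesRegularity.Theorems.EulerZoomLiouvillePowerGaugeEulerLiouvilleWeakAxisymCasimirLaw
import Summits.NavierStokesRegularity.NavierStokesRegularity.Theorems.EulerZoomLiouvillePowerGaugeEulerLiouvilleWeakEtaRenormalisationUnconditional
import HarnessLib

/-!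
# Crux `EulerZoomLiouville.PowerGaugeEulerLiouville` (stmt-NavierStokesRegularity-19832), weak stratum, line `weak_axisym`:
# THE AXISYMMETRIC SWIRL-FREE WEAK MEMBER IS TRIVIAL (composition X0 ∘ X1a ∘ X1b ∘ X2, by name)

Route №10 `EulerZoomLiouville` (NavierStokesRegularity), crux E = stmt-NavierStokesRegularity-19832; width seat ns-ezl-w1 g9 under the LEAD ns-typeII-p2.

The line `Cruxes/PowerGaugeEulerLiouville/Lines/weak_axisym.lean` (ns-idea-11) reduces the Ukhovskii–Yudovich axisymmetric swirl-free weak stratum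
of the self-similar branch to four registered stubs, all of which are now tree theorems:

* X0  `WeakEulerian.weakVorticityEquation` (p705122): the weak vorticity equation of a weak exactly self-similar member;
* X1a `WeakAxisym.axisymReduction` (ns-ezl-w2 g6, p704941): on the stratum the vorticity is azimuthal, `Ω = η·(k×y)` a.e., and the Casimir
  `η = ⟪Ω, k×y⟫/ϱ²` solves the damped transport law `div(Wη) = (2γ−1)η`;
* X1b `WeakAxisym.etaRenormalisation_unconditional` (p709301 + the tree's DiPerna–Lions commutator lemma `SobolevGradCommutatorLocal`): `η` is renormalised;
* X2  `WeakAxisym.casimirRace` (p702731): a member with azimuthal vorticity and a renormalised `L²_loc` Casimir of growth `m < 1` is trivial.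

This file records the COMPOSITION as one member, stated with the line's reducible definitions unfolded (so that the LEAD can wire it by name
as an alternative of `IsWeakConfinedCurl` that reads «axisymmetric swirl-free weak profile with `η ∈ L²_loc` of growth `m < 1`», discharging
the clauses X0/X1a/X1b carried so far as hypotheses of alternative 5):

* `WeakAxisym.axisymNoSwirl_trivial` — `InClass ρ u p H c → IsExactlySelfSimilar ρ u p V P → IsProfileGradient ρ V G → HasTransportDivergence ρ V →
  IsWeakAxisymNoSwirl V G → u = 0` a.e. on the past slab, every `ρ ∈ (0, ½]`.

WHAT THIS IS NOT: not NS, not E, not the crux: the weak stratum OFF the axisymmetric swirl-free class (`stub_axisymFace`, X3) is untouched; 19832 is OPEN.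
-/

noncomputable section

-- flat `Theorems/<Route><Decl>…` files of one crux share the namespace of the crux (tree convention)
set_option linter.dupNamespace false

open MeasureTheory Set Filter Topology Metric Function TopologicalSpace ContinuousLinearMap
open scoped ENNReal NNReal RealInnerProductSpace ContDiff

namespace Summit.NavierStokesRegularity.NavierStokesRegularity.Theorems.PowerGaugeEulerLiouville.WeakAxisym

open Literature.Analysis Literature.Analysis.FunctionSpaces Literature.Analysis.FluidPDE
open Summit.NavierStokesRegularity.NavierStokesRegularity.Theorems.PowerGaugeEulerLiouville

/-- **The axisymmetric swirl-free weak exactly self-similar member is trivial** (every `ρ ∈ (0, ½]`): for a member of the class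
(`InClass`, unfolded) that is exactly self-similar with profile `(V, P)` (`IsExactlySelfSimilar`), DiPerna–Lions data `(V, G)`
(`IsProfileGradient`), `div W = 3γ` (`HasTransportDivergence`), on the Ukhovskii–Yudovich axisymmetric swirl-free stratum
(`IsWeakAxisymNoSwirl V G`: `G(k×y) = k×V` a.e., `⟪V, k×y⟫ = 0` a.e., `V_ϱ/ϱ ∈ L²_loc`, `η = ⟪curl, k×y⟫/ϱ² ∈ L²_loc` of growth `m < 1`),
`u = 0` a.e. on the past slab.  Proof = X2 `casimirRace` fed by X0 `weakVorticityEquation`, X1a `axisymReduction`, X1b `etaRenormalisation_unconditional`. -/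
theorem axisymNoSwirl_trivial {ρ : ℝ} (hρ : 0 < ρ) (hρh : ρ ≤ 1 / 2)
    {u : ℝ → EuclideanSpace ℝ (Fin 3) → EuclideanSpace ℝ (Fin 3)} {p : ℝ → EuclideanSpace ℝ (Fin 3) → ℝ}
    {H : ℝ → EuclideanSpace ℝ (Fin 3) → EuclideanSpace ℝ (Fin 3) →L[ℝ] EuclideanSpace ℝ (Fin 3)} {c : ℝ≥0}
    {V : EuclideanSpace ℝ (Fin 3) → EuclideanSpace ℝ (Fin 3)} {P : EuclideanSpace ℝ (Fin 3) → ℝ}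
    {G : EuclideanSpace ℝ (Fin 3) → EuclideanSpace ℝ (Fin 3) →L[ℝ] EuclideanSpace ℝ (Fin 3)}
    (hcls : IsSuitableWeakSolutionOn (slab (EuclideanSpace ℝ (Fin 3)) (Set.Iio 0) isOpen_Iio) 0 0 u p ∧
      HasWeakSpatialGradientOn (slab (EuclideanSpace ℝ (Fin 3)) (Set.Iio 0) isOpen_Iio) u H ∧
      (∀ a : ℝ, 0 < a →
        ENNReal.ofReal (a ^ (2 * ρ)) * cknA a (0 : ℝ × EuclideanSpace ℝ (Fin 3)) u +
            ENNReal.ofReal (a ^ ρ) * cknE a (0 : ℝ × EuclideanSpace ℝ (Fin 3)) H +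
          ENNReal.ofReal (a ^ (2 * ρ)) * cknD a (0 : ℝ × EuclideanSpace ℝ (Fin 3)) p ≤ (c : ℝ≥0∞)))
    (hss : (∀ τ : ℝ, τ < 0 → u τ = selfSimilarCollapse (1 / (2 + ρ)) 0 V τ) ∧
      (∀ τ : ℝ, τ < 0 → p τ = selfSimilarCollapsePressure (1 / (2 + ρ)) 0 P τ))
    (hPG : HasWeakFDerivOn (⊤ : Opens (EuclideanSpace ℝ (Fin 3))) volume V G ∧
      (∀ r : ℝ, MemLp G 2 (volume.restrict (ball (0 : EuclideanSpace ℝ (Fin 3)) r))) ∧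
      (∀ r : ℝ, MemLp V 6 (volume.restrict (ball (0 : EuclideanSpace ℝ (Fin 3)) r))) ∧
      HasWeakFDerivOn (⊤ : Opens (EuclideanSpace ℝ (Fin 3))) volume (selfSimilarTransport (1 / (2 + ρ)) 0 V)
        (fun x => (1 / (2 + ρ)) • ContinuousLinearMap.id ℝ (EuclideanSpace ℝ (Fin 3)) + G x))
    (hdiv : ∀ φ : EuclideanSpace ℝ (Fin 3) → ℝ, IsTestFunctionOn (⊤ : Opens (EuclideanSpace ℝ (Fin 3))) φ →
      ∫ y, ⟪selfSimilarTransport (1 / (2 + ρ)) 0 V y, gradient φ y⟫ = -(3 * (1 / (2 + ρ))) * ∫ y, φ y)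
    (hax : (∀ᵐ y ∂(volume : Measure (EuclideanSpace ℝ (Fin 3))),
        G y (WithLp.toLp 2 ![-(y 1), y 0, 0]) = WithLp.toLp 2 ![-(V y 1), V y 0, 0]) ∧
      (∀ᵐ y ∂(volume : Measure (EuclideanSpace ℝ (Fin 3))), ⟪V y, WithLp.toLp 2 ![-(y 1), y 0, 0]⟫ = 0) ∧
      (∀ r : ℝ, MemLp (fun y => ⟪V y, WithLp.toLp 2 ![y 0, y 1, 0]⟫ / (y 0 ^ 2 + y 1 ^ 2)) 2
        (volume.restrict (ball (0 : EuclideanSpace ℝ (Fin 3)) r))) ∧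
      (∀ r : ℝ, MemLp (fun y => ⟪curlCLM (G y), WithLp.toLp 2 ![-(y 1), y 0, 0]⟫ / (y 0 ^ 2 + y 1 ^ 2)) 2
        (volume.restrict (ball (0 : EuclideanSpace ℝ (Fin 3)) r))) ∧
      (∃ C m : ℝ, m < 1 ∧ ∀ R : ℝ, 1 ≤ R →
        ∫ y in ball (0 : EuclideanSpace ℝ (Fin 3)) R,
          (⟪curlCLM (G y), WithLp.toLp 2 ![-(y 1), y 0, 0]⟫ / (y 0 ^ 2 + y 1 ^ 2)) ^ 2 ≤ C * R ^ m)) :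
    Function.uncurry u =ᵐ[volume.restrict (Set.Iio (0 : ℝ) ×ˢ (Set.univ : Set (EuclideanSpace ℝ (Fin 3))))] 0 := by
  -- X0: the weak vorticity equation
  have hvort := WeakEulerian.weakVorticityEquation hρ hρh hcls hss hPG hdiv
  -- X1a: azimuthality and the damped Casimir law
  obtain ⟨hazi, hθ⟩ := axisymReduction hρ hρh hPG hdiv hvort hax
  -- X1b: renormalisation (DiPerna–Lions, unconditional)
  have hren := etaRenormalisation_unconditional hρ hρh hPG hdiv hax.2.2.2.1 hθ
  -- X2: the Casimir race
  exact casimirRace hρ hρh hcls hss hPG hazi hax.2.2.2.1 hax.2.2.2.2 hren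

end Summit.NavierStokesRegularity.NavierStokesRegularity.Theorems.PowerGaugeEulerLiouville.WeakAxisym

end
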